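import Summits.KontsevichZagierPeriods.KontsevichZagierPeriods.Theses.FurushoPentagon
import Summits.KontsevichZagierPeriods.KontsevichZagierPeriods.Theses.Deregularisation
import Literature.NumberTheory.Transcendental.KZUnfolding

/-!
# Sketch — crux HoffmanRelationInKZ (stmt-KontsevichZagierPeriods-3930), idea `dilation-homotopy-transposition`

First lemmas of the line, stated over existing declarations only (they must elaborate; proofs are
NOT claimed here).  Coordinates on `Fin (n+3) → ℝ`: `u = z 0`, `x₁ = z 1`,
`x' = (z 2, …, z (n+1))`, `λ = z (Fin.last (n+2))`.
-/

noncomputable section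

open Set MeasureTheory
open Literature.NumberTheory.Transcendental

namespace Summit.KontsevichZagierPeriods.KontsevichZagierPeriods.Cruxes.HoffmanRelationInKZ.DilationHomotopy

/-- FIRST LEMMA (dilation homotopy ⇒ shear defect).  For a kernel `G` on the open `(n+1)`-cube with
DILATION DERIVATIVE `K μ x' = d/dμ (μ · G(μ, x'))`, the shear-defect pair of route Deregularisation
`A_G = [{u < x₁}, G(x)/(1−u)]`, `B_G = [(0,1)^{n+2}, (G(x) − u·G(u x₁, x'))/(1−u)]` is KZ-equivalent
as soon as the two PEAK representations with the common integrand `K(λ·x₁, x')/(1−u)` — on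
`{u < x₁}` (all `λ`) and on `{u < λ}` (all `x₁`) — exist (i.e. are absolutely convergent).
Intended proof: THREE moves — Newton–Leibniz along `λ ∈ [0,1]` over `A_G` and along `λ ∈ [u,1]`
over `B_G`, both with the RATIONAL primitive `λ · G(λ x₁, x')/(1−u)`, and the coordinate
transposition `x₁ ↔ λ` (a `KZ.permRel` instance) between the two peaks, whose integrand depends on
`(λ, x₁)` only through `λ·x₁` — plus null-boundary bookkeeping (`KZ.of_mem_levelRel_of_volume_eq_zero`). -/
def DilationHomotopy : Prop :=
  ∀ (n : ℕ) (G : (Fin (n + 1) → ℝ) → ℝ) (K : ℝ → (Fin n → ℝ) → ℝ)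
    (r r' : KZ.IntegralRep (n + 2)) (R R' : KZ.IntegralRep (n + 3)),
    (∀ x' : Fin n → ℝ, (∀ i, x' i ∈ Ioo (0:ℝ) 1) →
        ∀ μ ∈ Ioo (0:ℝ) 1, HasDerivAt (fun m : ℝ => m * G (Fin.cons m x')) (K μ x') μ) →
    (∀ x' : Fin n → ℝ, (∀ i, x' i ∈ Ioo (0:ℝ) 1) →
        ContinuousOn (fun m : ℝ => m * G (Fin.cons m x')) (Icc 0 1)) →
    IsSemialgebraicFunOn ℚ {x : Fin (n + 1) → ℝ | ∀ i, x i ∈ Ioo (0:ℝ) 1} G →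
    r.domain = {t | (∀ i, t i ∈ Ioo (0:ℝ) 1) ∧ t 0 < t 1} →
    EqOn r.integrand (fun t => G (Fin.tail t) / (1 - t 0)) r.domain →
    r'.domain = {t | ∀ i, t i ∈ Ioo (0:ℝ) 1} →
    EqOn r'.integrand
      (fun t => (G (Fin.tail t) - t 0 * G (Function.update (Fin.tail t) 0 (t 0 * t 1))) / (1 - t 0))
      r'.domain →
    R.domain = {z | (∀ i, z i ∈ Ioo (0:ℝ) 1) ∧ z 0 < z 1} →
    EqOn R.integrand
      (fun z => K (z (Fin.last (n + 2)) * z 1) (fun i : Fin n => z i.succ.succ.castSucc) / (1 - z 0))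
      R.domain →
    R'.domain = {z | (∀ i, z i ∈ Ioo (0:ℝ) 1) ∧ z 0 < z (Fin.last (n + 2))} →
    EqOn R'.integrand
      (fun z => K (z (Fin.last (n + 2)) * z 1) (fun i : Fin n => z i.succ.succ.castSucc) / (1 - z 0))
      R'.domain →
    KZ.Equivalent r r'

/-- Its three single-move constituents, as they would be cut into stubs.
(a) PEAK TRANSPOSITION: the two peaks are equivalent (one `permRel` move + null sets). -/
def PeakTransposition : Prop :=
  ∀ (n : ℕ) (K : ℝ → (Fin n → ℝ) → ℝ) (R R' : KZ.IntegralRep (n + 3)),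
    R.domain = {z | (∀ i, z i ∈ Ioo (0:ℝ) 1) ∧ z 0 < z 1} →
    EqOn R.integrand
      (fun z => K (z (Fin.last (n + 2)) * z 1) (fun i : Fin n => z i.succ.succ.castSucc) / (1 - z 0))
      R.domain →
    R'.domain = {z | (∀ i, z i ∈ Ioo (0:ℝ) 1) ∧ z 0 < z (Fin.last (n + 2))} →
    EqOn R'.integrand
      (fun z => K (z (Fin.last (n + 2)) * z 1) (fun i : Fin n => z i.succ.succ.castSucc) / (1 - z 0))
      R'.domain →
    KZ.Equivalent R R'

/-- (b) DESCENT TO `A_G`: Newton–Leibniz along `λ ∈ [0,1]`, primitive `λ·G(λx₁,x')/(1−u)`,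
`F(1) − F(0) = G(x)/(1−u)`. -/
def DescentA : Prop :=
  ∀ (n : ℕ) (G : (Fin (n + 1) → ℝ) → ℝ) (K : ℝ → (Fin n → ℝ) → ℝ)
    (r : KZ.IntegralRep (n + 2)) (R : KZ.IntegralRep (n + 3)),
    (∀ x' : Fin n → ℝ, (∀ i, x' i ∈ Ioo (0:ℝ) 1) →
        ∀ μ ∈ Ioo (0:ℝ) 1, HasDerivAt (fun m : ℝ => m * G (Fin.cons m x')) (K μ x') μ) →
    (∀ x' : Fin n → ℝ, (∀ i, x' i ∈ Ioo (0:ℝ) 1) →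
        ContinuousOn (fun m : ℝ => m * G (Fin.cons m x')) (Icc 0 1)) →
    IsSemialgebraicFunOn ℚ {x : Fin (n + 1) → ℝ | ∀ i, x i ∈ Ioo (0:ℝ) 1} G →
    r.domain = {t | (∀ i, t i ∈ Ioo (0:ℝ) 1) ∧ t 0 < t 1} →
    EqOn r.integrand (fun t => G (Fin.tail t) / (1 - t 0)) r.domain →
    R.domain = {z | (∀ i, z i ∈ Ioo (0:ℝ) 1) ∧ z 0 < z 1} →
    EqOn R.integrand
      (fun z => K (z (Fin.last (n + 2)) * z 1) (fun i : Fin n => z i.succ.succ.castSucc) / (1 - z 0))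
      R.domain →
    KZ.of R - KZ.of r ∈ KZ.relations

/-- (c) DESCENT TO `B_G`: Newton–Leibniz along `λ ∈ [u,1]`, same primitive,
`F(1) − F(u) = (G(x) − u G(u x₁, x'))/(1−u)` — the difference quotient is produced WHOLE, never
split into its two (separately divergent) summands. -/
def DescentB : Prop :=
  ∀ (n : ℕ) (G : (Fin (n + 1) → ℝ) → ℝ) (K : ℝ → (Fin n → ℝ) → ℝ)
    (r' : KZ.IntegralRep (n + 2)) (R' : KZ.IntegralRep (n + 3)),
    (∀ x' : Fin n → ℝ, (∀ i, x' i ∈ Ioo (0:ℝ) 1) →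
        ∀ μ ∈ Ioo (0:ℝ) 1, HasDerivAt (fun m : ℝ => m * G (Fin.cons m x')) (K μ x') μ) →
    (∀ x' : Fin n → ℝ, (∀ i, x' i ∈ Ioo (0:ℝ) 1) →
        ContinuousOn (fun m : ℝ => m * G (Fin.cons m x')) (Icc 0 1)) →
    IsSemialgebraicFunOn ℚ {x : Fin (n + 1) → ℝ | ∀ i, x i ∈ Ioo (0:ℝ) 1} G →
    r'.domain = {t | ∀ i, t i ∈ Ioo (0:ℝ) 1} →
    EqOn r'.integrand
      (fun t => (G (Fin.tail t) - t 0 * G (Function.update (Fin.tail t) 0 (t 0 * t 1))) / (1 - t 0))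
      r'.domain →
    R'.domain = {z | (∀ i, z i ∈ Ioo (0:ℝ) 1) ∧ z 0 < z (Fin.last (n + 2))} →
    EqOn R'.integrand
      (fun z => K (z (Fin.last (n + 2)) * z 1) (fun i : Fin n => z i.succ.succ.castSucc) / (1 - z 0))
      R'.domain →
    KZ.of R' - KZ.of r' ∈ KZ.relations

/-- The composition (a) ∧ (b) ∧ (c) ⇒ the dilation homotopy lemma is pure algebra in
`KZ.relations` (an `AddSubgroup`).  Recorded as a statement; a 6-line proof. -/
theorem dilationHomotopy_of_parts (ha : PeakTransposition) (hb : DescentA) (hc : DescentB) :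
    DilationHomotopy := by
  intro n G K r r' R R' hK hC hG hr hri hr' hr'i hR hRi hR' hR'i
  have h1 : KZ.of R - KZ.of r ∈ KZ.relations := hb n G K r R hK hC hG hr hri hR hRi
  have h2 : KZ.of R' - KZ.of r' ∈ KZ.relations := hc n G K r' R' hK hC hG hr' hr'i hR' hR'i
  have h3 : KZ.of R - KZ.of R' ∈ KZ.relations := ha n K R R' hR hRi hR' hR'i
  have : KZ.of r - KZ.of r' = (KZ.of R' - KZ.of r') + (KZ.of R - KZ.of R') - (KZ.of R - KZ.of r) := by
    abel
  show KZ.of r - KZ.of r' ∈ KZ.relations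
  rw [this]
  exact KZ.relations.sub_mem (KZ.relations.add_mem h2 h3) h1

/-! ### Calibration: the weight-4 shear defect of route Deregularisation (stmt-3904)

`G = 1/(1 − x₁x₂x₃)`, `K(μ, x') = 1/(1 − μ x₂ x₃)²`; the peak kernel is
`1/((1−u)(1 − λ x₁ x₂ x₃)²)`, positive, of finite integral (= Σ_N H_N/N³ = 5ζ(4)/4 by Tonelli), so
both peaks exist and `ScalingDefectWeightFour` follows from `DilationHomotopy`. -/

/-- The weight-4 peak pair (explicit data; the existence claim is that these integrands are
absolutely integrable on the stated domains). -/
def PeakWeightFourExists : Prop :=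
  ∃ R R' : KZ.IntegralRep 5,
    R.domain = {z | (∀ i, z i ∈ Ioo (0:ℝ) 1) ∧ z 0 < z 1} ∧
    EqOn R.integrand (fun z => 1 / ((1 - z 0) * (1 - z 4 * z 1 * z 2 * z 3) ^ 2)) R.domain ∧
    R'.domain = {z | (∀ i, z i ∈ Ioo (0:ℝ) 1) ∧ z 0 < z 4} ∧
    EqOn R'.integrand (fun z => 1 / ((1 - z 0) * (1 - z 4 * z 1 * z 2 * z 3) ^ 2)) R'.domain

/-- Cheapest validator of the line: the existing rank-2 crux of route Deregularisation becomes a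
corollary. -/
def WeightFourCorollary : Prop :=
  DilationHomotopy → PeakWeightFourExists →
    Summit.KontsevichZagierPeriods.KontsevichZagierPeriods.Theses.Deregularisation.ScalingDefectWeightFour

/-! ### Transfer to the crux: Hoffman(s) ⇐ shear defect for the cubical MZV integrand `f_s`

`f_s(x) = ∏_l T_{l−1}/(1 − T_l)`, `T_l = x₀ ⋯ x_{p_l − 1}`, `p_l = s₁ + ⋯ + s_l` (Kontsevich's
formula pulled back along `t_j = x₀⋯x_{j}`), a rational function with non-negative Taylor
coefficients; its dilation derivative is non-negative, so both peaks exist by Tonelli. -/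

/-- End of block `l` (0-based prefix sums). -/
def blockEnd (s : List ℕ) (l : ℕ) : ℕ := (s.take l).sum

/-- Block product `T_l(x) = ∏_{j < p_l} x_j` (`T_0 = 1`). -/
def blockProd (s : List ℕ) (l : ℕ) (x : Fin (MZV.weight s) → ℝ) : ℝ :=
  ∏ j : Fin (MZV.weight s), (if (j : ℕ) < blockEnd s l then x j else 1)

/-- The cubical (Soudères/Cartier) integrand of `ζ(s)` on `(0,1)^{weight s}`. -/
def cubicalIntegrand (s : List ℕ) (x : Fin (MZV.weight s) → ℝ) : ℝ :=
  ∏ l : Fin s.length, blockProd s l x / (1 - blockProd s (l + 1) x)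

/-- The shear `x₀ ↦ u·x₀` on the cube variables (written without `Function.update` so that no
`NeZero (weight s)` instance is needed). -/
def shear (s : List ℕ) (u : ℝ) (x : Fin (MZV.weight s) → ℝ) : Fin (MZV.weight s) → ℝ :=
  fun j => if (j : ℕ) = 0 then u * x j else x j

/-- C⁺(s): the shear defect for `f_s` — `A_{f_s} ≡ B_{f_s}`. -/
def CubicalShearDefect (s : List ℕ) : Prop :=
  ∀ (r r' : KZ.IntegralRep (MZV.weight s + 1)),
    r.domain = {t | (∀ i, t i ∈ Ioo (0:ℝ) 1) ∧ t 0 < t 1} →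
    EqOn r.integrand (fun t => cubicalIntegrand s (Fin.tail t) / (1 - t 0)) r.domain →
    r'.domain = {t | ∀ i, t i ∈ Ioo (0:ℝ) 1} →
    EqOn r'.integrand
      (fun t => (cubicalIntegrand s (Fin.tail t) - t 0 * cubicalIntegrand s (shear s (t 0) (Fin.tail t)))
        / (1 - t 0)) r'.domain →
    KZ.Equivalent r r'

/-- TRANSFER: the crux follows from `C⁺(s)` for all admissible `s` by two CONVERGENT dissections
(rank cells of `u` among the simplex coordinates on the `A` side; the exact block partial-fraction
identity `(f_s(x) − u f_s(ux₀,x'))/(1−u) = Σ_l g_l + Σ_l h_l` on the `B` side; each piece a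
positive cubical MZV integrand up to a coordinate permutation and the cubical→simplicial change of
variables). -/
def HoffmanOfCubicalShear : Prop :=
  (∀ s : List ℕ, MZV.IsAdmissible s → CubicalShearDefect s) →
    Summit.KontsevichZagierPeriods.KontsevichZagierPeriods.Theses.FurushoPentagon.HoffmanRelationInKZ

/-- Sanity of the block bookkeeping: for `s = (2,1)` the blocks end at 2 and 3. -/
example : blockEnd [2, 1] 1 = 2 ∧ blockEnd [2, 1] 2 = 3 := by decide

end Summit.KontsevichZagierPeriods.KontsevichZagierPeriods.Cruxes.HoffmanRelationInKZ.DilationHomotopy
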